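import Summits.BirchSwinnertonDyer.BirchSwinnertonDyer.Theorems.ManinLocalTwoThreeAtkinLehnerEtaFiftySix
import Summits.BirchSwinnertonDyer.BirchSwinnertonDyer.Theorems.ManinLocalTwoThreeEtaIdentityReductionForty
import HarnessLib

/-!
# The cusp `1/8` of `X₀(56)` through `W₇`: orbit decomposition `A = g·A₀·Tʲ`, transport of `q`-limits through `τ ↦ (σ+1)/7` and `Tʲ`,
# and the Ligozat bounds of `U`, `V` at the six other cusps

Cell bsd-f2-manin, route `ManinLocalTwoThree` (crux C2 `ManinOddAtFour`, stmt-22967: `2² ∣ 56`), prover seat p2 gen 28; sequel to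
`AtkinLehnerEtaFiftySix` (`U∘A₀ = U∘β⁻¹`, `V∘A₀ = V∘β⁻¹`, `P|A₀ = −(8σ+1)²/7·Q∘β⁻¹`, …, `β⁻¹ : σ ↦ (σ+1)/7`).  The cusps of `X₀(56)` are
`1/c`, `c ∣ 56` (all of width `56/gcd(c², 56)`, all rational); the fibre of `X₀(56) → 56a1` over `O` is `{∞, 1/8}` and every object of the
level-`56` programme (`U`, `V`, `P`, `Q`) has its poles there.  This file turns «zero / bounded at the cusp `1/8`» into «zero / bounded at `∞`»:

* §1 ORBIT: `A ∈ SL₂(ℤ) ∖ Γ₀(56)` with `8 ∣ c(A)` factors as `A = g·A₀·Tʲ`, `g ∈ Γ₀(56)`, `A₀ = (1 0; 8 1)`, `T = (1 1; 0 1)`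
  (`7 ∤ c/8`; `j ≡ (d − c/8)·(c/8)⁻¹ (mod 7)`);
* §2 TRANSPORT: `Im(Tʲσ) = Im σ` and `Im((σ+1)/7) = Im σ/7 → ∞`, so `F|(B·Tʲ) → 0` iff `F|B → 0`, and `G∘β⁻¹ → 0` if `G → 0` (also bounded
  versions); the chain rule `((G∘β⁻¹)∘ofComplex)′(σ) = G′((σ+1)/7)/7`; hence for a `Γ₀(56)`-invariant `F` of weight `k`, `F|A → 0` at every
  `A` of the class of `1/8` as soon as `F|A₀ → 0` for the lower-unipotent `A₀` (`isZeroAtImInfty_slash_of_cusp_eighth`);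
* §3 LIGOZAT at the other cusps: for `8 ∤ c(A)` (the classes `1, 1/2, 1/4, 1/7, 1/14, 1/28`) `U∘A` and `V∘A` are bounded at `i∞`
  (orders `0,0,2,0,·,0,2,·` and `0,2,1,0,·,2,1,·`), and `U`, `V` are `Γ₀(56)`-invariant (Newman).

No definition, no named fact, no sorry; nothing here proves C2, Manin's conjecture or BSD. [cite: DiamondShurman2005, §3.8] [cite: Ligozat1975, Ch. 3]
[cite: AtkinLehner1970, Lemma 7]
-/

set_option autoImplicit false
-- lint-debt: the directory name repeats the summit name (sibling precedent `ManinLocalTwoThreeEtaIdentityReductionForty.lean`)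
set_option linter.dupNamespace false

noncomputable section

open Complex Filter Topology Set Asymptotics
open UpperHalfPlane hiding I
open scoped Real Topology Manifold MatrixGroups ModularForm
open ModularForm CongruenceSubgroup
open Literature.NumberTheory.ModularForms
open Literature.NumberTheory.EllipticCurves Literature.NumberTheory.EllipticCurves.ModularForms

namespace Summit.BirchSwinnertonDyer.BirchSwinnertonDyer.Theorems.ManinLocalTwoThree.AtkinLehnerCuspFiftySix

open CuspToolkit AtkinLehnerEtaFiftySix

/-! ## §1 The orbit of the cusp `1/8`: `A = g·A₀·Tʲ` -/

/-- `7 ∤ c/8` when `8 ∣ c` and `A ∉ Γ₀(56)`. [folklore] -/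
theorem not_seven_dvd_of_not_mem {A : SL(2, ℤ)} {c' : ℤ} (hc : A 1 0 = 8 * c') (hA : A ∉ Gamma0 56) : ¬ (7 : ℤ) ∣ c' := by
  rintro ⟨m, hm⟩
  apply hA
  rw [Gamma0_mem]
  refine (ZMod.intCast_zmod_eq_zero_iff_dvd _ 56).mpr ⟨m, ?_⟩
  rw [hc, hm]; ring

/-- **`A = g·A₀·Tʲ`** for `A ∈ SL₂(ℤ) ∖ Γ₀(56)` with `8 ∣ c(A)`: `g ∈ Γ₀(56)`, `A₀ = (1 0; 8 1)`, `j ∈ ℤ` (the cusp `A∞` is the cusp `1/8` of `X₀(56)`,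
of width `7`). [cite: DiamondShurman2005, §3.8] -/
theorem exists_decomp_cusp_eighth {A : SL(2, ℤ)} (h8 : (8 : ℤ) ∣ A 1 0) (hA : A ∉ Gamma0 56) :
    ∃ (g A₀ : SL(2, ℤ)) (j : ℤ), g ∈ Gamma0 56 ∧ A₀ 0 0 = 1 ∧ A₀ 0 1 = 0 ∧ A₀ 1 0 = 8 ∧ A₀ 1 1 = 1 ∧
      A = g * A₀ * ModularGroup.T ^ j := by
  obtain ⟨c', hc'⟩ := h8
  have h7 := not_seven_dvd_of_not_mem hc' hA
  -- `u c' ≡ 1 (mod 7)`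
  have hcop : IsCoprime c' 7 := by
    rw [Int.isCoprime_iff_gcd_eq_one]
    rcases (Nat.dvd_prime (by norm_num : Nat.Prime 7)).mp (Int.gcd_dvd_natAbs_right c' 7 |>.trans (by norm_num)) with h | h
    · exact h
    · exfalso; apply h7
      have := Int.gcd_dvd_left c' 7
      rw [h] at this
      exact_mod_cast this
  obtain ⟨u, v, huv⟩ := hcop
  set d : ℤ := A 1 1 with hd
  set j : ℤ := u * (d - c') with hj
  let A₀ : SL(2, ℤ) := ⟨!![1, 0; 8, 1], by norm_num [Matrix.det_fin_two_of]⟩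
  let B : SL(2, ℤ) := ⟨!![1, 0; -8, 1], by norm_num [Matrix.det_fin_two_of]⟩
  have hBA : B * A₀ = 1 := by
    ext i j
    fin_cases i <;> fin_cases j <;> simp [A₀, B, Matrix.mul_apply, Fin.sum_univ_two]
  refine ⟨A * ModularGroup.T ^ (-j) * B, A₀, j, ?_, rfl, rfl, rfl, rfl, ?_⟩
  · rw [Gamma0_mem]
    have hentry : ((A * ModularGroup.T ^ (-j) * B : SL(2, ℤ)) : Matrix (Fin 2) (Fin 2) ℤ) 1 0
        = A 1 0 - 8 * (A 1 0 * (-j) + A 1 1) := by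
      simp [B, Matrix.mul_apply, Fin.sum_univ_two, ModularGroup.coe_T_zpow]
      ring
    rw [show ((A * ModularGroup.T ^ (-j) * B : SL(2, ℤ)) 1 0 : ℤ) = A 1 0 - 8 * (A 1 0 * (-j) + A 1 1) from hentry]
    refine (ZMod.intCast_zmod_eq_zero_iff_dvd _ 56).mpr ⟨c' * u * (d - c') + (c' - d) * v, ?_⟩
    rw [hc', ← hd, hj]
    linear_combination (-8 * c' + 8 * d) * huv
  · rw [mul_assoc (A * ModularGroup.T ^ (-j)), hBA, mul_one, mul_assoc, ← zpow_add, neg_add_cancel, zpow_zero, mul_one]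

/-! ## §2 Transport of `q`-limits through `Tʲ` and through `β⁻¹ : σ ↦ (σ + 1)/7` -/

/-- `Tʲσ → i∞` as `σ → i∞` (`Im` is unchanged). [folklore] -/
theorem tendsto_T_zpow_smul (j : ℤ) : Tendsto (fun τ : ℍ ↦ (ModularGroup.T ^ j : SL(2, ℤ)) • τ) atImInfty atImInfty := by
  rw [atImInfty, tendsto_comap_iff]
  have : UpperHalfPlane.im ∘ (fun τ : ℍ ↦ (ModularGroup.T ^ j : SL(2, ℤ)) • τ) = UpperHalfPlane.im := by
    funext τ
    simp only [Function.comp_apply]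
    rw [← UpperHalfPlane.coe_im, ModularGroup.coe_T_zpow_smul_eq]
    simp
  rw [this]
  exact tendsto_comap

/-- `(F|ₖTʲ)(τ) = F(Tʲτ)` (the automorphy factor of `Tʲ` is `1`). [folklore] -/
theorem slash_T_zpow_apply (F : ℍ → ℂ) (k j : ℤ) (τ : ℍ) :
    (F ∣[k] (ModularGroup.T ^ j : SL(2, ℤ))) τ = F ((ModularGroup.T ^ j : SL(2, ℤ)) • τ) := by
  rw [SL_slash_apply, ModularGroup.denom_apply]
  simp [ModularGroup.coe_T_zpow]

/-- **`F|ₖ(B·Tʲ) → 0` at `i∞` if `F|ₖB → 0`.** [folklore] -/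
theorem isZeroAtImInfty_slash_mul_T_zpow (F : ℍ → ℂ) (k : ℤ) (B : SL(2, ℤ)) (j : ℤ) (h : IsZeroAtImInfty (F ∣[k] B)) :
    IsZeroAtImInfty (F ∣[k] (B * ModularGroup.T ^ j)) := by
  rw [SlashAction.slash_mul]
  have h2 : IsZeroAtImInfty (fun τ : ℍ ↦ (F ∣[k] B) ((ModularGroup.T ^ j : SL(2, ℤ)) • τ)) := h.comp (tendsto_T_zpow_smul j)
  exact Tendsto.congr (fun τ ↦ (slash_T_zpow_apply _ k j τ).symm) h2

/-- **`F|ₖ(B·Tʲ)` is bounded at `i∞` if `F|ₖB` is.** [folklore] -/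
theorem isBoundedAtImInfty_slash_mul_T_zpow (F : ℍ → ℂ) (k : ℤ) (B : SL(2, ℤ)) (j : ℤ) (h : IsBoundedAtImInfty (F ∣[k] B)) :
    IsBoundedAtImInfty (F ∣[k] (B * ModularGroup.T ^ j)) := by
  rw [SlashAction.slash_mul]
  have h2 : IsBoundedAtImInfty (fun τ : ℍ ↦ (F ∣[k] B) ((ModularGroup.T ^ j : SL(2, ℤ)) • τ)) := h.comp_tendsto (tendsto_T_zpow_smul j)
  exact h2.congr_left fun τ ↦ (slash_T_zpow_apply _ k j τ).symm

/-- `G((σ+1)/7) → 0` at `i∞` if `G → 0` at `i∞`. [folklore] -/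
theorem isZeroAtImInfty_comp_affPt {G : ℍ → ℂ} (h : IsZeroAtImInfty G) :
    IsZeroAtImInfty (fun σ : ℍ ↦ G (affPt 1 1 7 one_pos (by norm_num) σ)) :=
  h.comp (tendsto_affPt_atImInfty 1 1 7 one_pos (by norm_num))

/-- `G((σ+1)/7)` is bounded at `i∞` if `G` is. [folklore] -/
theorem isBoundedAtImInfty_comp_affPt {G : ℍ → ℂ} (h : IsBoundedAtImInfty G) :
    IsBoundedAtImInfty (fun σ : ℍ ↦ G (affPt 1 1 7 one_pos (by norm_num) σ)) :=
  h.comp_tendsto (tendsto_affPt_atImInfty 1 1 7 one_pos (by norm_num))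

/-- A `Tendsto`-transport: `H((σ+1)/7) → L` at `i∞` if `H → L` at `i∞`. [folklore] -/
theorem tendsto_comp_affPt {H : ℍ → ℂ} {L : ℂ} (h : Tendsto H atImInfty (𝓝 L)) :
    Tendsto (fun σ : ℍ ↦ H (affPt 1 1 7 one_pos (by norm_num) σ)) atImInfty (𝓝 L) :=
  h.comp (tendsto_affPt_atImInfty 1 1 7 one_pos (by norm_num))

/-- **Chain rule through `β⁻¹`**: `((G∘β⁻¹)∘ofComplex)′(σ) = G′((σ+1)/7)/7` for holomorphic `G` on `ℍ`. [folklore] -/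
theorem deriv_comp_affPt {G : ℍ → ℂ} (hG : MDifferentiable 𝓘(ℂ) 𝓘(ℂ) G) (σ : ℍ) :
    deriv ((fun s : ℍ ↦ G (affPt 1 1 7 one_pos (by norm_num) s)) ∘ ofComplex) σ
      = (1 / 7 : ℂ) * deriv (G ∘ ofComplex) ((affPt 1 1 7 one_pos (by norm_num) σ : ℍ) : ℂ) := by
  have hdiff := UpperHalfPlane.mdifferentiable_iff.mp hG
  have him : ∀ z : ℂ, 0 < z.im → 0 < ((z + 1) / 7).im := fun z hz ↦ by
    rw [show (z + 1) / 7 = (z + 1) * ((7 : ℝ) : ℂ)⁻¹ by push_cast; ring, Complex.mul_im]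
    simp
    positivity
  have hpt : ∀ z : ℂ, ∀ hz : 0 < z.im, ((affPt 1 1 7 one_pos (by norm_num) (ofComplex z) : ℍ) : ℂ) = (z + 1) / 7 := fun z hz ↦ by
    rw [coe_affPt, ofComplex_apply_of_im_pos hz]
    push_cast
    ring
  have heq : ((fun s : ℍ ↦ G (affPt 1 1 7 one_pos (by norm_num) s)) ∘ ofComplex) =ᶠ[𝓝 (σ : ℂ)]
      ((G ∘ ofComplex) ∘ fun z : ℂ ↦ (z + 1) / 7) := by
    filter_upwards [isOpen_upperHalfPlaneSet.mem_nhds σ.im_pos] with z hz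
    simp only [Function.comp_apply]
    congr 1
    ext1
    rw [hpt z hz, ofComplex_apply_of_im_pos (him z hz)]
  rw [heq.deriv_eq]
  have hσ' : 0 < (((σ : ℂ) + 1) / 7).im := him _ σ.im_pos
  have h1 : HasDerivAt (G ∘ ofComplex) (deriv (G ∘ ofComplex) (((σ : ℂ) + 1) / 7)) (((σ : ℂ) + 1) / 7) :=
    ((hdiff _ hσ').differentiableAt (isOpen_upperHalfPlaneSet.mem_nhds hσ')).hasDerivAt
  have h2 : HasDerivAt (fun z : ℂ ↦ (z + 1) / 7) (1 / 7) (σ : ℂ) := by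
    simpa using ((hasDerivAt_id (σ : ℂ)).add_const 1).div_const 7
  rw [(h1.comp (σ : ℂ) h2).deriv, show ((affPt 1 1 7 one_pos (by norm_num) σ : ℍ) : ℂ) = ((σ : ℂ) + 1) / 7 by
    rw [coe_affPt]; push_cast; ring]
  ring

/-- **Zero at the whole class of the cusp `1/8`**: if `F` is `Γ₀(56)`-invariant in weight `k` and `F|ₖA₀ → 0` at `i∞` for every
`A₀ = (1 0; 8 1)` (given by its entries), then `F|ₖA → 0` for every `A ∉ Γ₀(56)` with `8 ∣ c(A)`. [cite: DiamondShurman2005, §3.8] -/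
theorem isZeroAtImInfty_slash_of_cusp_eighth (F : ℍ → ℂ) (k : ℤ) (hF : ∀ γ : SL(2, ℤ), γ ∈ Gamma0 56 → F ∣[k] γ = F)
    (hA₀ : ∀ A₀ : SL(2, ℤ), A₀ 0 0 = 1 → A₀ 0 1 = 0 → A₀ 1 0 = 8 → A₀ 1 1 = 1 → IsZeroAtImInfty (F ∣[k] A₀))
    {A : SL(2, ℤ)} (h8 : (8 : ℤ) ∣ A 1 0) (hA : A ∉ Gamma0 56) : IsZeroAtImInfty (F ∣[k] A) := by
  obtain ⟨g, A₀, j, hg, h00, h01, h10, h11, rfl⟩ := exists_decomp_cusp_eighth h8 hA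
  rw [SlashAction.slash_mul, SlashAction.slash_mul, hF g hg, ← SlashAction.slash_mul]
  exact isZeroAtImInfty_slash_mul_T_zpow F k A₀ j (hA₀ A₀ h00 h01 h10 h11)

/-- **Bounded at the whole class of the cusp `1/8`** (same, with «bounded»). [cite: DiamondShurman2005, §3.8] -/
theorem isBoundedAtImInfty_slash_of_cusp_eighth (F : ℍ → ℂ) (k : ℤ) (hF : ∀ γ : SL(2, ℤ), γ ∈ Gamma0 56 → F ∣[k] γ = F)
    (hA₀ : ∀ A₀ : SL(2, ℤ), A₀ 0 0 = 1 → A₀ 0 1 = 0 → A₀ 1 0 = 8 → A₀ 1 1 = 1 → IsBoundedAtImInfty (F ∣[k] A₀))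
    {A : SL(2, ℤ)} (h8 : (8 : ℤ) ∣ A 1 0) (hA : A ∉ Gamma0 56) : IsBoundedAtImInfty (F ∣[k] A) := by
  obtain ⟨g, A₀, j, hg, h00, h01, h10, h11, rfl⟩ := exists_decomp_cusp_eighth h8 hA
  rw [SlashAction.slash_mul, SlashAction.slash_mul, hF g hg, ← SlashAction.slash_mul]
  exact isBoundedAtImInfty_slash_mul_T_zpow F k A₀ j (hA₀ A₀ h00 h01 h10 h11)

/-! ## §3 `U`, `V` are `Γ₀(56)`-invariant and bounded at the cusps `a/c` with `8 ∤ c` -/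

/-- Newman's conditions for `U` in weight `0` at level `56`. [folklore] -/
theorem newmanCond_U : NewmanCond 56 (expFn [(2, -1), (4, 3), (8, -2), (14, -1), (28, 3), (56, -2)]) 0 :=
  ⟨by decide, by decide, by decide, ⟨8192 * 7 ^ 3, by decide⟩⟩

/-- Newman's conditions for `V` in weight `0` at level `56`. [folklore] -/
theorem newmanCond_V : NewmanCond 56 (expFn [(1, -1), (2, 2), (4, 1), (7, -1), (8, -2), (14, 2), (28, 1), (56, -2)]) 0 :=
  ⟨by decide, by decide, by decide, ⟨1024 * 7 ^ 3, by decide⟩⟩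

/-- `U(γτ) = U(τ)` for `γ ∈ Γ₀(56)`. [folklore] -/
theorem U_smul (γ : SL(2, ℤ)) (hγ : γ ∈ Gamma0 56) (τ : ℍ) :
    etaQuotient 56 (expFn [(2, -1), (4, 3), (8, -2), (14, -1), (28, 3), (56, -2)]) (γ • τ)
      = etaQuotient 56 (expFn [(2, -1), (4, 3), (8, -2), (14, -1), (28, 3), (56, -2)]) τ := by
  have h := etaQuotient_smul_of_mem_Gamma0 56 (by norm_num) _ 0 ⟨0, by simp⟩ newmanCond_U hγ τ
  rwa [zpow_zero, one_mul] at h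

/-- `V(γτ) = V(τ)` for `γ ∈ Γ₀(56)`. [folklore] -/
theorem V_smul (γ : SL(2, ℤ)) (hγ : γ ∈ Gamma0 56) (τ : ℍ) :
    etaQuotient 56 (expFn [(1, -1), (2, 2), (4, 1), (7, -1), (8, -2), (14, 2), (28, 1), (56, -2)]) (γ • τ)
      = etaQuotient 56 (expFn [(1, -1), (2, 2), (4, 1), (7, -1), (8, -2), (14, 2), (28, 1), (56, -2)]) τ := by
  have h := etaQuotient_smul_of_mem_Gamma0 56 (by norm_num) _ 0 ⟨0, by simp⟩ newmanCond_V hγ τ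
  rwa [zpow_zero, one_mul] at h

/-- Ligozat's order at level `56` is `≥ 0` at every `c` with `8 ∤ c`, given the values at the divisors `t` with `8 ∤ t`. [cite: Ligozat1975, Ch. 3] -/
theorem cuspOrder24_nonneg_of_not_dvd8 (r : ℕ → ℤ)
    (h : ∀ t ∈ Nat.divisors 56, ¬ 8 ∣ t → 0 ≤ cuspOrder24 56 r t) {c : ℤ} (hc : ¬ (8 : ℤ) ∣ c) :
    0 ≤ cuspOrder24 56 r c := by
  rw [cuspOrder24_eq_gcd]
  refine h _ (Nat.mem_divisors.mpr ⟨Nat.gcd_dvd_left _ _, by norm_num⟩) fun hd ↦ hc ?_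
  exact Int.natCast_dvd.mpr (hd.trans (Nat.gcd_dvd_right _ _))

/-- **`U∘A` is bounded at `i∞` when `8 ∤ c(A)`** (Ligozat orders `0, 0, 2, 0, 0, 2` at the cusps `1/c`, `c = 1, 2, 4, 7, 14, 28`). [cite: Ligozat1975, Ch. 3] -/
theorem isBoundedAtImInfty_U_smul {A : SL(2, ℤ)} (hA : ¬ (8 : ℤ) ∣ A 1 0) :
    IsBoundedAtImInfty (fun τ : ℍ ↦ etaQuotient 56 (expFn [(2, -1), (4, 3), (8, -2), (14, -1), (28, 3), (56, -2)]) (A • τ)) :=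
  isBoundedAtImInfty_etaQuotient_smul 56 (by norm_num) _ (by decide) A (cuspOrder24_nonneg_of_not_dvd8 _ (by decide) hA)

/-- **`V∘A` is bounded at `i∞` when `8 ∤ c(A)`** (Ligozat orders `0, 2, 1, 0, 2, 1` at the cusps `1/c`, `c = 1, 2, 4, 7, 14, 28`). [cite: Ligozat1975, Ch. 3] -/
theorem isBoundedAtImInfty_V_smul {A : SL(2, ℤ)} (hA : ¬ (8 : ℤ) ∣ A 1 0) :
    IsBoundedAtImInfty (fun τ : ℍ ↦ etaQuotient 56 (expFn [(1, -1), (2, 2), (4, 1), (7, -1), (8, -2), (14, 2), (28, 1), (56, -2)]) (A • τ)) :=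
  isBoundedAtImInfty_etaQuotient_smul 56 (by norm_num) _ (by decide) A (cuspOrder24_nonneg_of_not_dvd8 _ (by decide) hA)

end Summit.BirchSwinnertonDyer.BirchSwinnertonDyer.Theorems.ManinLocalTwoThree.AtkinLehnerCuspFiftySix

end
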